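import Summits.ResolutionOfSingularities.ResolutionOfSingularities.Theorems.FrobeniusLadderFInjectiveMacaulayficationPolyAutRowTransport
import HarnessLib

/-!
# THE FIRST CUSTOMER OF THE TRANSPORT LEMMA: P2d4C `z² + x⁴z + y³ + u³ + t³` (p = 2) ALONG `σ₅ : z ↦ z + x⁵` — a census row / germ for `V(σ₅ f) = V(z² + x⁴z + x⁹ + x¹⁰ + y³ + u³ + t³)`
# at the origin IS a census row / germ for P2d4C at the origin
# (crux `FInjectiveMacaulayfication` stmt-ResolutionOfSingularities-15315, chain w45a; res-L1-w45a-plan-1 RULING R22.4 (2)/(3) «transport lemma (stub-1) + PILOT of the class-route retro-fit on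
# f′ = σ₅(f_{P2d4C}) (stub-2 g11) … so that the transport lemma has a concrete first customer»; seat res-L1-w45a-stub-1 g13 (transport consultant); sequel of ✓ `…PolyAutRowTransport`)

[OURS · L1 W4.5a] Support file (`--supports stmt-ResolutionOfSingularities-15315 --as helper`); def-free; UNCONDITIONAL; no named fact; NOT a statement of any manuscript.
Nothing of the crux is proved; this file proves NO row — it only moves a row/germ for `f′` (to be supplied by the pilot) to P2d4C. AI-written (AI review is weaker than expert review).

Letters: `(x,y,u,t,z) = X0..X4`, `f = X4² + X0⁴X4 + X1³ + X2³ + X3³` (P2d4C, as in ✓ `…P2d4CChar2Germ`), `f′ = X4² + X0⁴X4 + X0⁹ + X0¹⁰ + X1³ + X2³ + X3³` (any spelling: `hf′` is an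
equation, bridge other spellings by `ring`).
* §1 `aeval_sigma5_f` — in characteristic 2, `σ₅ f = f′` for `σ₅ : X4 ↦ X4 + X0⁵` (the cross term `2x⁵z` dies); `exists_sigma5` — `σ₅` as a ring automorphism with `σ₅(Xᵢ)`, `σ₅⁻¹(Xᵢ)`
  constant-term-free and `σ₅ f = f′` (✓ `PolyAutRowTransport.exists_translate`).
* §2 ★ `pointFloorRow_P2d4C_of_sigma5` — the census row ⟨LEGAL, NOT FULL (`FullCl p`), CURED⟩ for the point floor of `V(f′)` at the origin ⇒ the same row for P2d4C at the origin
  (✓ `pointFloorRow_of_algEquiv`); ★ `fInjectivizationGermAt_P2d4C_of_sigma5` — `FInjectivizationGermAt p` likewise (✓ `fInjectivizationGermAt_of_algEquiv`).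
[folklore; cite: Hartshorne1977, I §1 (affine coordinate changes)] [cite: GortzWedhorn2020, (13.19)]
-/

-- single-problem summit: the doubled namespace component is forced
set_option linter.dupNamespace false

noncomputable section

namespace Summit.ResolutionOfSingularities.ResolutionOfSingularities.Theorems.FInjectiveMacaulayfication.P2d4CSigma5Transport

open CategoryTheory CategoryTheory.Limits AlgebraicGeometry TopologicalSpace IsLocalRing MvPolynomial
open Literature.AlgebraicGeometry.Resolution
open Summit.ResolutionOfSingularities.ResolutionOfSingularities.Theorems.FInjectiveMacaulayfication
open SliceableCentre GermForm PolyAutRowTransport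

variable (k : Type) [Field k]

/-! ## §1 `σ₅ f = f′` in characteristic 2 -/

/-- **`σ₅ f = f′`** (`σ₅ : z ↦ z + x⁵`, characteristic 2): `(z + x⁵)² + x⁴(z + x⁵) + y³ + u³ + t³ = z² + x⁴z + x⁹ + x¹⁰ + y³ + u³ + t³` since `2x⁵z = 0`. [folklore] -/
theorem aeval_sigma5_f [CharP k 2] (f f' : MvPolynomial (Fin 5) k) (hf : f = X 4 ^ 2 + X 0 ^ 4 * X 4 + X 1 ^ 3 + X 2 ^ 3 + X 3 ^ 3)
    (hf' : f' = X 4 ^ 2 + X 0 ^ 4 * X 4 + X 0 ^ 9 + X 0 ^ 10 + X 1 ^ 3 + X 2 ^ 3 + X 3 ^ 3) :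
    aeval (fun l : Fin 5 => if l = 4 then X 4 + C (1 : k) * X 0 ^ 5 else (X l : MvPolynomial (Fin 5) k)) f = f' := by
  have h2 : (2 : MvPolynomial (Fin 5) k) = 0 := by
    have h := CharP.cast_eq_zero (MvPolynomial (Fin 5) k) 2
    simpa using h
  have e : aeval (fun l : Fin 5 => if l = 4 then X 4 + C (1 : k) * X 0 ^ 5 else (X l : MvPolynomial (Fin 5) k)) f = f' + 2 * (X 0 ^ 5 * X 4) := by
    subst hf hf'
    simp only [map_add, map_mul, map_pow, aeval_X, C_1, one_mul]
    simp only [Fin.isValue, Fin.reduceEq, if_false, if_true]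
    ring
  rw [e, h2, zero_mul, add_zero]

/-- **`σ₅` as a ring automorphism of `k[x,y,u,t,z]`** with `σ₅(Xᵢ)`, `σ₅⁻¹(Xᵢ)` constant-term-free and `σ₅ f = f′` (characteristic 2). [folklore] -/
theorem exists_sigma5 [CharP k 2] (f f' : MvPolynomial (Fin 5) k) (hf : f = X 4 ^ 2 + X 0 ^ 4 * X 4 + X 1 ^ 3 + X 2 ^ 3 + X 3 ^ 3)
    (hf' : f' = X 4 ^ 2 + X 0 ^ 4 * X 4 + X 0 ^ 9 + X 0 ^ 10 + X 1 ^ 3 + X 2 ^ 3 + X 3 ^ 3) :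
    ∃ φ : MvPolynomial (Fin 5) k ≃+* MvPolynomial (Fin 5) k,
      (∀ l : Fin 5, constantCoeff (φ (X l)) = 0) ∧ (∀ l : Fin 5, constantCoeff (φ.symm (X l)) = 0) ∧ φ f = f' := by
  obtain ⟨φ, hφ, h₁, h₂⟩ := exists_translate k (0 : Fin 5) 4 (by decide) (1 : k) 5 (by norm_num)
  exact ⟨φ, h₁, h₂, by rw [hφ]; exact aeval_sigma5_f k f f' hf hf'⟩

/-! ## §2 ★ The P2d4C row / germ from the `f′` row / germ -/

/-- ★ **A CENSUS ROW FOR `V(f′)` AT THE ORIGIN IS A CENSUS ROW FOR P2d4C AT THE ORIGIN** (characteristic 2; `FullCl p` for any `p`): for every blowing up of `Spec 𝒪_{V(f),v′}` along the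
point floor — LEGAL ∧ NOT FULL ∧ CURED — from the same statement for `V(f′)`, `f′ = σ₅ f`. [folklore; cite: GortzWedhorn2020, (13.19)] -/
theorem pointFloorRow_P2d4C_of_sigma5 (p : ℕ) [CharP k 2] (f f' : MvPolynomial (Fin 5) k) (hf : f = X 4 ^ 2 + X 0 ^ 4 * X 4 + X 1 ^ 3 + X 2 ^ 3 + X 3 ^ 3)
    (hf' : f' = X 4 ^ 2 + X 0 ^ 4 * X 4 + X 0 ^ 9 + X 0 ^ 10 + X 1 ^ 3 + X 2 ^ 3 + X 3 ^ 3)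
    (hrow : ∀ (v : Spec (.of (MvPolynomial (Fin 5) k ⧸ Ideal.span {f'}))),
      v.asIdeal = Ideal.span (Set.range fun j : Fin 5 => Ideal.Quotient.mk (Ideal.span {f'}) (X j)) →
      ∀ (S' : Scheme.{0}) (g₁ : S' ⟶ Spec ((Spec (.of (MvPolynomial (Fin 5) k ⧸ Ideal.span {f'}))).presheaf.stalk v)),
        IsBlowup g₁ ((affineBlowup.idealSheaf (Ideal.span (Set.range fun j : Fin 5 => Ideal.Quotient.mk (Ideal.span {f'}) (X j)))).comap
          ((Spec (.of (MvPolynomial (Fin 5) k ⧸ Ideal.span {f'}))).fromSpecStalk v)) →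
        (((affineBlowup.idealSheaf (Ideal.span (Set.range fun j : Fin 5 => Ideal.Quotient.mk (Ideal.span {f'}) (X j)))).comap
            ((Spec (.of (MvPolynomial (Fin 5) k ⧸ Ideal.span {f'}))).fromSpecStalk v)) ≠ ⊥ ∧
          ((((affineBlowup.idealSheaf (Ideal.span (Set.range fun j : Fin 5 => Ideal.Quotient.mk (Ideal.span {f'}) (X j)))).comap
            ((Spec (.of (MvPolynomial (Fin 5) k ⧸ Ideal.span {f'}))).fromSpecStalk v)).support :
              Set (Spec ((Spec (.of (MvPolynomial (Fin 5) k ⧸ Ideal.span {f'}))).presheaf.stalk v))) ⊆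
            (Scheme.regularLocus (Spec ((Spec (.of (MvPolynomial (Fin 5) k ⧸ Ideal.span {f'}))).presheaf.stalk v)))ᶜ) ∧
          (∀ s : S', g₁.base s ≠ closedPoint _ → s ∈ Scheme.regularLocus S') ∧ (∀ s : S', CMCl (S'.presheaf.stalk s))) ∧
        (∃ s : S', g₁.base s = closedPoint _ ∧ ¬ FullCl p (S'.presheaf.stalk s)) ∧
        (∃ 𝓚 : S'.IdealSheafData, 𝓚 ≠ ⊥ ∧ (∀ s ∈ (𝓚.support : Set S'), g₁.base s = closedPoint _) ∧
          ∀ (S'' : Scheme.{0}) (π : S'' ⟶ S'), IsBlowup π 𝓚 → ∀ s : S'', FullCl p (S''.presheaf.stalk s))) :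
    ∀ (v' : Spec (.of (MvPolynomial (Fin 5) k ⧸ Ideal.span {f}))),
      v'.asIdeal = Ideal.span (Set.range fun j : Fin 5 => Ideal.Quotient.mk (Ideal.span {f}) (X j)) →
      ∀ (S' : Scheme.{0}) (g₁ : S' ⟶ Spec ((Spec (.of (MvPolynomial (Fin 5) k ⧸ Ideal.span {f}))).presheaf.stalk v')),
        IsBlowup g₁ ((affineBlowup.idealSheaf (Ideal.span (Set.range fun j : Fin 5 => Ideal.Quotient.mk (Ideal.span {f}) (X j)))).comap
          ((Spec (.of (MvPolynomial (Fin 5) k ⧸ Ideal.span {f}))).fromSpecStalk v')) →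
        (((affineBlowup.idealSheaf (Ideal.span (Set.range fun j : Fin 5 => Ideal.Quotient.mk (Ideal.span {f}) (X j)))).comap
            ((Spec (.of (MvPolynomial (Fin 5) k ⧸ Ideal.span {f}))).fromSpecStalk v')) ≠ ⊥ ∧
          ((((affineBlowup.idealSheaf (Ideal.span (Set.range fun j : Fin 5 => Ideal.Quotient.mk (Ideal.span {f}) (X j)))).comap
            ((Spec (.of (MvPolynomial (Fin 5) k ⧸ Ideal.span {f}))).fromSpecStalk v')).support :
              Set (Spec ((Spec (.of (MvPolynomial (Fin 5) k ⧸ Ideal.span {f}))).presheaf.stalk v'))) ⊆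
            (Scheme.regularLocus (Spec ((Spec (.of (MvPolynomial (Fin 5) k ⧸ Ideal.span {f}))).presheaf.stalk v')))ᶜ) ∧
          (∀ s : S', g₁.base s ≠ closedPoint _ → s ∈ Scheme.regularLocus S') ∧ (∀ s : S', CMCl (S'.presheaf.stalk s))) ∧
        (∃ s : S', g₁.base s = closedPoint _ ∧ ¬ FullCl p (S'.presheaf.stalk s)) ∧
        (∃ 𝓚 : S'.IdealSheafData, 𝓚 ≠ ⊥ ∧ (∀ s ∈ (𝓚.support : Set S'), g₁.base s = closedPoint _) ∧
          ∀ (S'' : Scheme.{0}) (π : S'' ⟶ S'), IsBlowup π 𝓚 → ∀ s : S'', FullCl p (S''.presheaf.stalk s)) := by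
  obtain ⟨φ, h₁, h₂, hφf⟩ := exists_sigma5 k f f' hf hf'
  exact pointFloorRow_of_algEquiv k p φ h₁ h₂ f f' hφf hrow

/-- ★ **The germ shape**: `FInjectivizationGermAt p` at the origin of `V(f′)` implies it at the origin of P2d4C (characteristic 2). [folklore] -/
theorem fInjectivizationGermAt_P2d4C_of_sigma5 (p : ℕ) [CharP k 2] (f f' : MvPolynomial (Fin 5) k) (hf : f = X 4 ^ 2 + X 0 ^ 4 * X 4 + X 1 ^ 3 + X 2 ^ 3 + X 3 ^ 3)
    (hf' : f' = X 4 ^ 2 + X 0 ^ 4 * X 4 + X 0 ^ 9 + X 0 ^ 10 + X 1 ^ 3 + X 2 ^ 3 + X 3 ^ 3)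
    (hgerm : ∀ v : Spec (.of (MvPolynomial (Fin 5) k ⧸ Ideal.span {f'})),
      v.asIdeal = Ideal.span (Set.range fun j : Fin 5 => Ideal.Quotient.mk (Ideal.span {f'}) (X j)) → FInjectivizationGermAt p v) :
    ∀ v' : Spec (.of (MvPolynomial (Fin 5) k ⧸ Ideal.span {f})),
      v'.asIdeal = Ideal.span (Set.range fun j : Fin 5 => Ideal.Quotient.mk (Ideal.span {f}) (X j)) → FInjectivizationGermAt p v' := by
  obtain ⟨φ, h₁, h₂, hφf⟩ := exists_sigma5 k f f' hf hf'
  exact fInjectivizationGermAt_of_algEquiv k p φ h₁ h₂ f f' hφf hgerm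

end Summit.ResolutionOfSingularities.ResolutionOfSingularities.Theorems.FInjectiveMacaulayfication.P2d4CSigma5Transport

end
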